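import Summits.QuantumFields.YangMills.Theorems.BalabanUVNodesN15KingModelAnalyticDeterminantSecondVariation
import HarnessLib

/-!
# BalabanUVNodes ∕ N15 — THE KING-MODEL RUNG (PART Ϯ-h): KING's (3.96) AT `n = 2` FOR THE BLOCK-FIELD NORMALISATION — TAYLOR TO SECOND ORDER WITH A TWO-SIDED REMAINDER:
# `tr(C(V)E) − ½β♯⁻²·tr(E²) ≤ ln det Δ_eff(U) − ln det Δ_eff(V) ≤ tr(C(V)E) − ½a⁻²·tr(E²)` (`C = Δ_eff⁻¹`, `E = Δ_eff(U) − Δ_eff(V)`, `β♯ = am²∕(a+m²)`, any two real-orthogonal backgrounds),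
# and the STRONG form of PART Ϭ-f's response sandwich: `tr(C(U)E) + ½a⁻²tr(E²) ≤ Δ ln det ≤ tr(C(V)E) − ½a⁻²tr(E²)` — the chord misses each tangent by at least `½a⁻²tr(E²)`
# (Track A, DAG node N15 = NE2; FAN-OUT v1.1 §N15 s3 «KING-MODEL RUNG … + what the curved case adds»; count-neutral)

HONEST FRAMING.  Count-neutral (cell `pub-ymgap`, seat `pub-ymgap-dag-n15-e` g54; `--supports stmt-QuantumFields-27247 --as helper` = K3ᴬ, KEY MAP v3).  King's one-level comparison model,
`𝕜 = ℝ` (real-orthogonal backgrounds; PART Ϭ-l∕Ϯ-g), `a, m² > 0`, `c ≥ 0`, nonempty fibre; interpolation linear in the OPERATOR.  King's (3.96) (p.669) expands `ln det(1+D) = tr D − ½tr D² + …`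
for a symmetric `D` with `‖D‖ < 1` and states the alternating bounds; PART Ϭ-h proved those AS PRINTED for `D ≥ 0`; THIS FILE gives the `n = 2` statement for King's block-field operator between two
backgrounds WITHOUT a smallness condition, with the remainder's size from the Loewner window `[β♯, a]` (Ϯ-g).  NOT (3.97)–(3.98); NOT a node discharge (N15 of record untouched); nothing
continuum ∕ ℝ⁴ ∕ OS ∕ Clay.

THE MECHANISM.  §1 a generic second-order Taylor inequality on `[0,1]` from one-sided bounds on the second derivative, by two monotonicity passes (Mathlib `antitoneOn_of_hasDerivWithinAt_nonpos` ∕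
`monotoneOn_…_nonneg`): `f′ = g`, `g′ = h`, `h ≤ −κ` ⟹ `f(1) − f(0) ≤ g(0) − κ∕2` (via `ψ = g − g(0) + κs ≤ 0`, then `φ = f − f(0) − sg(0) + ½κs² ≤ 0`), and `h ≥ −κ′` ⟹ `f(1) − f(0) ≥ g(0) − κ′∕2`;
§2 `f = ln det Δ_t` (Ϭ-l `hasDerivAt_log_det_effLapU_segment`), `g = tr(Δ_t⁻¹E)`, `h = −tr(Δ_t⁻¹EΔ_t⁻¹E)` (Ϯ-g `hasDerivAt_trace_inv_effLapU_segment`) with Ϯ-g `king_second_variation_bounds`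
(`κ = a⁻²tr(E²)`, `κ′ = β♯⁻²tr(E²)`) ⟹ ★★★★ **`king396_two_sided_remainder`**; the same from the other endpoint ⟹ ★★★★ **`king_response_sandwich_strong`**; ★★★ `log_det_effLapU_sub_lt_re_trace`
(STRICT first-order bound when `Δ_eff(U) ≠ Δ_eff(V)`).

PRIOR TREE ART (by name, not restated): Ϭ-l `hasDerivAt_log_det_effLapU_segment`, Ϯ-g `hasDerivAt_trace_inv_effLapU_segment`∕`king_second_variation_bounds`, Mathlib
`monotoneOn_of_hasDerivWithinAt_nonneg`∕`antitoneOn_of_hasDerivWithinAt_nonpos`, `Matrix.trace_mul_conjTranspose_self_eq_zero_iff` (not needed: positivity of `tr(E²)` via Ϯ-g).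
Dedup (rg at filing): basename 0 files; `taylor_two_upper_of_deriv2_le|taylor_two_lower_of_deriv2_ge|king396_two_sided_remainder|king_response_sandwich_strong|log_det_effLapU_sub_lt_re_trace` 0 tree files.
Locators: [King1986] (3.94)–(3.96) p.669, (3.89)–(3.90) pp.668–669, (2.14) p.653, (4.33) p.674; [Klingen1990] Ch. V §11 (15) p.141.  0 `sorry`, 0 `def`.
-/

noncomputable section

open scoped BigOperators ComplexConjugate ComplexOrder Matrix.Norms.L2Operator
open Finset Matrix Set

namespace Summit.QuantumFields.YangMills.BalabanUVNodes.N15KingModelRung.Analytic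

open Literature.MathematicalPhysics.QuantumFieldTheory.Balaban1983to89.B5Prop11Plancherel (Tor fine)
open Summit.QuantumFields.YangMills.BalabanUVNodes.N15KingModelRung.CovariantBlock (BlockTree effLapU)

/-! ## §1 Second-order Taylor on `[0,1]` from one-sided bounds on the second derivative -/

section Taylor

/-- A function with nonpositive derivative on `[0,1]` and value `0` at `0` is `≤ 0` on `[0,1]`. [folklore] -/
theorem nonpos_of_hasDerivAt_nonpos_Icc {ψ ψ' : ℝ → ℝ} (hψ : ∀ s ∈ Icc (0 : ℝ) 1, HasDerivAt ψ (ψ' s) s) (hψ' : ∀ s ∈ Icc (0 : ℝ) 1, ψ' s ≤ 0) (h0 : ψ 0 = 0)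
    {s : ℝ} (hs : s ∈ Icc (0 : ℝ) 1) : ψ s ≤ 0 := by
  have hcont : ContinuousOn ψ (Icc (0 : ℝ) 1) := continuousOn_of_forall_continuousAt fun x hx => (hψ x hx).continuousAt
  have hanti : AntitoneOn ψ (Icc (0 : ℝ) 1) :=
    antitoneOn_of_hasDerivWithinAt_nonpos (convex_Icc 0 1) hcont
      (fun x hx => by rw [interior_Icc] at hx; exact (hψ x (Ioo_subset_Icc_self hx)).hasDerivWithinAt)
      (fun x hx => by rw [interior_Icc] at hx; exact hψ' x (Ioo_subset_Icc_self hx))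
  have h := hanti (left_mem_Icc.mpr zero_le_one) hs hs.1
  rwa [h0] at h

/-- … and with nonnegative derivative it is `≥ 0`. [folklore] -/
theorem nonneg_of_hasDerivAt_nonneg_Icc {ψ ψ' : ℝ → ℝ} (hψ : ∀ s ∈ Icc (0 : ℝ) 1, HasDerivAt ψ (ψ' s) s) (hψ' : ∀ s ∈ Icc (0 : ℝ) 1, 0 ≤ ψ' s) (h0 : ψ 0 = 0)
    {s : ℝ} (hs : s ∈ Icc (0 : ℝ) 1) : 0 ≤ ψ s := by
  have hcont : ContinuousOn ψ (Icc (0 : ℝ) 1) := continuousOn_of_forall_continuousAt fun x hx => (hψ x hx).continuousAt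
  have hmono : MonotoneOn ψ (Icc (0 : ℝ) 1) :=
    monotoneOn_of_hasDerivWithinAt_nonneg (convex_Icc 0 1) hcont
      (fun x hx => by rw [interior_Icc] at hx; exact (hψ x (Ioo_subset_Icc_self hx)).hasDerivWithinAt)
      (fun x hx => by rw [interior_Icc] at hx; exact hψ' x (Ioo_subset_Icc_self hx))
  have h := hmono (left_mem_Icc.mpr zero_le_one) hs hs.1
  rwa [h0] at h

/-- ★★ **SECOND-ORDER TAYLOR, UPPER**: `f′ = g`, `g′ = h` on `[0,1]` and `h ≤ −κ` there ⟹ `f(1) − f(0) ≤ g(0) − κ∕2`. [cite: King1986, (3.96) p.669] -/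
theorem taylor_two_upper_of_deriv2_le {f g h : ℝ → ℝ} {κ : ℝ} (hf : ∀ s ∈ Icc (0 : ℝ) 1, HasDerivAt f (g s) s) (hg : ∀ s ∈ Icc (0 : ℝ) 1, HasDerivAt g (h s) s)
    (hh : ∀ s ∈ Icc (0 : ℝ) 1, h s ≤ -κ) : f 1 - f 0 ≤ g 0 - κ / 2 := by
  -- first pass: `ψ(s) = g(s) − g(0) + κs ≤ 0`
  have hψ : ∀ s ∈ Icc (0 : ℝ) 1, g s - g 0 + κ * s ≤ 0 := fun s hs =>
    nonpos_of_hasDerivAt_nonpos_Icc (ψ := fun s => g s - g 0 + κ * s) (ψ' := fun s => h s + κ)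
      (fun x hx => by
        have h1 := ((hg x hx).sub_const (g 0)).add ((hasDerivAt_id x).const_mul κ)
        exact h1.congr_deriv (by simp))
      (fun x hx => by linarith [hh x hx]) (by simp) hs
  -- second pass: `φ(s) = f(s) − f(0) − s·g(0) + ½κs² ≤ 0`
  have hφ := nonpos_of_hasDerivAt_nonpos_Icc (ψ := fun s => f s - f 0 - s * g 0 + κ / 2 * (s * s)) (ψ' := fun s => g s - g 0 + κ * s)
      (fun x hx => by
        have h1 := (((hf x hx).sub_const (f 0)).sub ((hasDerivAt_id x).mul_const (g 0))).add (((hasDerivAt_id x).mul (hasDerivAt_id x)).const_mul (κ / 2))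
        exact h1.congr_deriv (by simp; ring))
      hψ (by simp) (right_mem_Icc.mpr zero_le_one)
  simp at hφ
  linarith

/-- ★★ **SECOND-ORDER TAYLOR, LOWER**: `f′ = g`, `g′ = h` on `[0,1]` and `−κ′ ≤ h` there ⟹ `g(0) − κ′∕2 ≤ f(1) − f(0)`. [cite: King1986, (3.96) p.669] -/
theorem taylor_two_lower_of_deriv2_ge {f g h : ℝ → ℝ} {κ' : ℝ} (hf : ∀ s ∈ Icc (0 : ℝ) 1, HasDerivAt f (g s) s) (hg : ∀ s ∈ Icc (0 : ℝ) 1, HasDerivAt g (h s) s)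
    (hh : ∀ s ∈ Icc (0 : ℝ) 1, -κ' ≤ h s) : g 0 - κ' / 2 ≤ f 1 - f 0 := by
  have hψ : ∀ s ∈ Icc (0 : ℝ) 1, 0 ≤ g s - g 0 + κ' * s := fun s hs =>
    nonneg_of_hasDerivAt_nonneg_Icc (ψ := fun s => g s - g 0 + κ' * s) (ψ' := fun s => h s + κ')
      (fun x hx => by
        have h1 := ((hg x hx).sub_const (g 0)).add ((hasDerivAt_id x).const_mul κ')
        exact h1.congr_deriv (by simp))
      (fun x hx => by linarith [hh x hx]) (by simp) hs
  have hφ := nonneg_of_hasDerivAt_nonneg_Icc (ψ := fun s => f s - f 0 - s * g 0 + κ' / 2 * (s * s)) (ψ' := fun s => g s - g 0 + κ' * s)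
      (fun x hx => by
        have h1 := (((hf x hx).sub_const (f 0)).sub ((hasDerivAt_id x).mul_const (g 0))).add (((hasDerivAt_id x).mul (hasDerivAt_id x)).const_mul (κ' / 2))
        exact h1.congr_deriv (by simp; ring))
      hψ (by simp) (right_mem_Icc.mpr zero_le_one)
  simp at hφ
  linarith

end Taylor

/-! ## §2 King's (3.96) at `n = 2` for the block-field operator between two backgrounds -/

section Model

variable {d : ℕ} {L : ℕ} [NeZero L] (T : BlockTree d L) (M : Fin (d + 1) → ℕ) [hM : ∀ μ, NeZero (M μ)]
variable {n : Type*} [Fintype n] [DecidableEq n] [Nonempty n]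
variable {a c m2 : ℝ} (ha : 0 < a) (hc : 0 ≤ c) (hm : 0 < m2)
variable {U V : Tor (fine L M) × Fin (d + 1) → Matrix n n ℝ} (hU : ∀ bd, U bd ∈ Matrix.unitaryGroup n ℝ) (hV : ∀ bd, V bd ∈ Matrix.unitaryGroup n ℝ)
include ha hc hm hU hV

/-- ★★★★ **KING's (3.96) AT `n = 2` WITH A TWO-SIDED REMAINDER**: for any two real-orthogonal backgrounds, with `C(V) = Δ_eff(V)⁻¹`, `E = Δ_eff(U) − Δ_eff(V)`, `β♯ = (a⁻¹+m⁻²)⁻¹`: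
`tr(C(V)E) − ½β♯⁻²·tr(E²) ≤ ln det Δ_eff(U) − ln det Δ_eff(V) ≤ tr(C(V)E) − ½a⁻²·tr(E²)` — first order (King's `tr D`, Ϭ-f) plus the NEGATIVE second-order term whose modulus lies between
`½a⁻²tr(E²)` and `½β♯⁻²tr(E²)` (Ϯ-g's curvature window), with no smallness assumption on `E`. [cite: King1986, (3.94)–(3.96) p.669, (3.89)–(3.90) pp.668–669, (2.14) p.653, (4.33) p.674;
Klingen1990, Ch. V §11 (15) p.141] -/
theorem king396_two_sided_remainder :
    ((effLapU T M a c m2 V)⁻¹ * (effLapU T M a c m2 U - effLapU T M a c m2 V)).trace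
          - 1 / 2 * (a⁻¹ + m2⁻¹) ^ 2 * ((effLapU T M a c m2 U - effLapU T M a c m2 V) * (effLapU T M a c m2 U - effLapU T M a c m2 V)).trace
        ≤ Real.log (effLapU T M a c m2 U).det - Real.log (effLapU T M a c m2 V).det
      ∧ Real.log (effLapU T M a c m2 U).det - Real.log (effLapU T M a c m2 V).det
        ≤ ((effLapU T M a c m2 V)⁻¹ * (effLapU T M a c m2 U - effLapU T M a c m2 V)).trace
          - 1 / 2 * a⁻¹ ^ 2 * ((effLapU T M a c m2 U - effLapU T M a c m2 V) * (effLapU T M a c m2 U - effLapU T M a c m2 V)).trace := by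
  set ΔV := effLapU T M a c m2 V with hΔV
  set E := effLapU T M a c m2 U - effLapU T M a c m2 V with hE
  set f : ℝ → ℝ := fun s => Real.log (ΔV + s • E).det with hf
  set g : ℝ → ℝ := fun s => ((ΔV + s • E)⁻¹ * E).trace with hg
  set h : ℝ → ℝ := fun s => -((ΔV + s • E)⁻¹ * E * (ΔV + s • E)⁻¹ * E).trace with hh
  have hfd : ∀ s ∈ Icc (0 : ℝ) 1, HasDerivAt f (g s) s := fun s hs => hasDerivAt_log_det_effLapU_segment T M ha hc hm hU hV hs
  have hgd : ∀ s ∈ Icc (0 : ℝ) 1, HasDerivAt g (h s) s := fun s hs => hasDerivAt_trace_inv_effLapU_segment T M ha hc hm hU hV hs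
  have hb : ∀ s ∈ Icc (0 : ℝ) 1, -((a⁻¹ + m2⁻¹) ^ 2 * (E * E).trace) ≤ h s ∧ h s ≤ -(a⁻¹ ^ 2 * (E * E).trace) :=
    fun s hs => king_second_variation_bounds T M ha hc hm hU hV hs
  have hup := taylor_two_upper_of_deriv2_le (κ := a⁻¹ ^ 2 * (E * E).trace) hfd hgd (fun s hs => (hb s hs).2)
  have hlo := taylor_two_lower_of_deriv2_ge (κ' := (a⁻¹ + m2⁻¹) ^ 2 * (E * E).trace) hfd hgd (fun s hs => (hb s hs).1)
  have ef1 : f 1 = Real.log (effLapU T M a c m2 U).det := by simp [hf, hE, hΔV]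
  have ef0 : f 0 = Real.log ΔV.det := by simp [hf]
  have eg0 : g 0 = (ΔV⁻¹ * E).trace := by simp [hg]
  rw [ef1, ef0, eg0] at hup hlo
  constructor <;> linarith

/-- ★★★★ **THE STRONG RESPONSE SANDWICH**: `tr(C(U)E) + ½a⁻²·tr(E²) ≤ ln det Δ_eff(U) − ln det Δ_eff(V) ≤ tr(C(V)E) − ½a⁻²·tr(E²)` — PART Ϭ-f's chord-between-tangents with the uniform
concavity modulus `a⁻²` of the Loewner ceiling `Δ_eff ≤ a`: the chord misses EACH endpoint tangent by at least `½a⁻²tr(E²)`. [cite: King1986, (3.94)–(3.96) p.669, (2.14) p.653; Klingen1990, Ch. V §11 (15) p.141] -/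
theorem king_response_sandwich_strong :
    ((effLapU T M a c m2 U)⁻¹ * (effLapU T M a c m2 U - effLapU T M a c m2 V)).trace
          + 1 / 2 * a⁻¹ ^ 2 * ((effLapU T M a c m2 U - effLapU T M a c m2 V) * (effLapU T M a c m2 U - effLapU T M a c m2 V)).trace
        ≤ Real.log (effLapU T M a c m2 U).det - Real.log (effLapU T M a c m2 V).det
      ∧ Real.log (effLapU T M a c m2 U).det - Real.log (effLapU T M a c m2 V).det
        ≤ ((effLapU T M a c m2 V)⁻¹ * (effLapU T M a c m2 U - effLapU T M a c m2 V)).trace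
          - 1 / 2 * a⁻¹ ^ 2 * ((effLapU T M a c m2 U - effLapU T M a c m2 V) * (effLapU T M a c m2 U - effLapU T M a c m2 V)).trace := by
  refine ⟨?_, (king396_two_sided_remainder T M ha hc hm hU hV).2⟩
  -- the upper bound from the other endpoint: swap `U ↔ V`
  have h := (king396_two_sided_remainder T M ha hc hm hV hU).2
  have e1 : effLapU T M a c m2 V - effLapU T M a c m2 U = -(effLapU T M a c m2 U - effLapU T M a c m2 V) := by abel
  rw [e1, Matrix.mul_neg, Matrix.trace_neg, neg_mul_neg] at h
  linarith

/-- ★★★ **STRICT FIRST ORDER**: if `Δ_eff(U) ≠ Δ_eff(V)` then `ln det Δ_eff(U) − ln det Δ_eff(V) < tr(C(V)E)` — Ϭ-f's `≤` is strict off the diagonal (`tr(E²) > 0` for a nonzero symmetric `E`;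
quantitatively by `½a⁻²tr(E²)`). [cite: King1986, (3.96) p.669; Klingen1990, Ch. V §11 (15) p.141] -/
theorem log_det_effLapU_sub_lt_re_trace (hne : effLapU T M a c m2 U ≠ effLapU T M a c m2 V) :
    Real.log (effLapU T M a c m2 U).det - Real.log (effLapU T M a c m2 V).det
      < ((effLapU T M a c m2 V)⁻¹ * (effLapU T M a c m2 U - effLapU T M a c m2 V)).trace := by
  have h := (king396_two_sided_remainder T M ha hc hm hU hV).2
  set E := effLapU T M a c m2 U - effLapU T M a c m2 V with hE
  have hEs : Eᵀ = E := by
    have h' := (isHermitian_effLapU T M ha hc hm hU).sub (isHermitian_effLapU T M ha hc hm hV)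
    have h'' : (effLapU T M a c m2 U)ᵀ - (effLapU T M a c m2 V)ᵀ = effLapU T M a c m2 U - effLapU T M a c m2 V := by
      simpa [Matrix.IsHermitian, Matrix.conjTranspose_eq_transpose_of_trivial, Matrix.transpose_sub] using h'
    rw [hE, Matrix.transpose_sub]; exact h''
  have hpos : 0 < (E * E).trace := by
    have hE0 : E ≠ 0 := sub_ne_zero.mpr hne
    have hsym : ∀ i j, E j i = E i j := fun i j => by
      have := congrFun (congrFun hEs i) j
      rwa [Matrix.transpose_apply] at this
    have htr : (E * E).trace = ∑ i, ∑ j, E i j ^ 2 := by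
      simp only [Matrix.trace, Matrix.diag_apply, Matrix.mul_apply]
      refine Finset.sum_congr rfl fun i _ => Finset.sum_congr rfl fun j _ => ?_
      rw [hsym i j, sq]
    rw [htr]
    obtain ⟨i, j, hij⟩ : ∃ i j, E i j ≠ 0 := by
      by_contra hcon
      push Not at hcon
      exact hE0 (Matrix.ext fun i j => by simpa using hcon i j)
    calc (0 : ℝ) < E i j ^ 2 := by positivity
      _ ≤ ∑ j', E i j' ^ 2 := Finset.single_le_sum (f := fun j' => E i j' ^ 2) (fun _ _ => sq_nonneg _) (Finset.mem_univ j)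
      _ ≤ ∑ i', ∑ j', E i' j' ^ 2 := Finset.single_le_sum (f := fun i' => ∑ j', E i' j' ^ 2) (fun _ _ => Finset.sum_nonneg fun _ _ => sq_nonneg _) (Finset.mem_univ i)
  have ha2 : 0 < 1 / 2 * a⁻¹ ^ 2 * (E * E).trace := by positivity
  linarith

end Model

end Summit.QuantumFields.YangMills.BalabanUVNodes.N15KingModelRung.Analytic

end
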